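import Mathlib.RingTheory.Polynomial.Bernstein
import Mathlib.Analysis.Real.Sqrt
import Mathlib.Algebra.BigOperators.Intervals
import Mathlib.Algebra.Order.Interval.Finset.SuccPred
import Mathlib.Tactic.LinearCombination
import Summits.PneNP.PneNP.Theorems.OneSliceSliceACZeroDefs

/-!
# Route OneSlice, crux `SliceACZero` (stmt-PneNP-2835), line `russo-window-ladder`: the binomial hazard estimate

Stub `stub_binomialHazard` of the skeleton `Summits/PneNP/PneNP/Cruxes/SliceACZero/Lines/russo-window-ladder.lean`.
With `q = j/N` (`0 < j < N`) and `B(ℓ) = binomPMF N q ℓ = C(N,ℓ) q^ℓ (1−q)^{N−ℓ} = P[Bin(N,q) = ℓ]`, the hybrid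
weight of the edge layer `i → i+1` seen from the slice `j` is `w(i) = P[X ≥ i+1]` (`j ≤ i`) or `P[X ≤ i]`
(`i < j`), `X ∼ Bin(N, j/N)` (`hybridWeight`). The stub: for an absolute constant `K₀` (here `K₀ = 40/3`),
`w(i) / ((N−i)·C(N,i)) ≤ (K₀/√j) · q^{i+1} (1−q)^{N−1−i}`, i.e. `w(i) ≤ K₀ (i+1) B(i+1) / √j`
(as `(N−i)C(N,i) = (i+1)C(N,i+1)`). Elementary proof with finite sums of reals only:
* the ratio identity `(ℓ+1)(1−q) B(ℓ+1) = (N−ℓ) q B(ℓ)`; at `q = j/N` the level `j` is a mode, and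
  `B(j+1) = j/(j+1)·B(j) ≥ B(j)/2`, `B(j−1) = (N−j)/(N−j+1)·B(j) ≥ B(j)/2`;
* log-concavity in product form, `B(b+t) B(a) ≤ B(a+t) B(b)` for `a ≤ b` (the ratios decrease in `ℓ`), whence
  the tail bounds `P[X ≥ i+1]·B(j+1) ≤ B(i+1)` (`j ≤ i`) and `P[X ≤ i]·B(j−1) ≤ B(i)` (`i < j`);
* the modal bound `B(j) ≥ 3/(20√j)`: variance `Σ_ℓ (ℓ−j)² B(ℓ) = j(1−q) ≤ j` (Mathlib's
  `bernsteinPolynomial.variance` evaluated at `q`), Chebyshev (`≥ 3/4` of the mass sits on the levels with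
  `(ℓ−j)² < 4j`) and counting (these lie in a window of `2⌊√(4j)⌋ + 1 ≤ 5√j` integers, each of mass `≤ B(j)`).

Vocabulary (`binomPMF`, `hybridWeight`, `binomPMF_nonneg`) from `Summits.PneNP.PneNP.Theorems.OneSliceSliceACZeroDefs`.
Not here: the sharp constant (`K₀ → √(2π)`; `1.06` suffices for `N ≤ 60` by brute force). [folklore]
-/

noncomputable section

namespace Summit.PneNP.PneNP.Cruxes.SliceACZero.RussoWindowLadder

open scoped BigOperators
open Finset

set_option linter.dupNamespace false -- D-0017: `Summit.PneNP.PneNP.…` repeats `PneNP` by design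

namespace BinomialHazard

/-! ### The binomial point masses: ratio identity and total mass -/

/-- The ratio identity `(ℓ+1)(1−q)·B(ℓ+1) = (N−ℓ)q·B(ℓ)` for `B = binomPMF N q` (with `ℕ`-subtraction on the
right, so that it holds for every `ℓ`: both sides vanish for `ℓ ≥ N`). [folklore] -/
theorem binomPMF_succ_ratio (N ℓ : ℕ) (q : ℝ) :
    ((ℓ : ℝ) + 1) * (1 - q) * binomPMF N q (ℓ + 1) = ((N - ℓ : ℕ) : ℝ) * q * binomPMF N q ℓ := by
  unfold binomPMF
  rcases lt_or_ge ℓ N with h | h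
  · have hc : ((N.choose (ℓ + 1) : ℕ) : ℝ) * ((ℓ : ℝ) + 1) = (N.choose ℓ : ℝ) * ((N - ℓ : ℕ) : ℝ) := by
      exact_mod_cast Nat.choose_succ_right_eq N ℓ
    have hp : (1 - q) ^ (N - ℓ) = (1 - q) ^ (N - (ℓ + 1)) * (1 - q) := by
      rw [← pow_succ]; congr 1; omega
    rw [hp, pow_succ]
    linear_combination (q ^ ℓ * q * ((1 - q) ^ (N - (ℓ + 1)) * (1 - q))) * hc
  · rw [Nat.choose_eq_zero_of_lt (by omega : N < ℓ + 1), Nat.sub_eq_zero_of_le h]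
    simp

/-- `B(ℓ) = 0` for `ℓ > N`. [folklore] -/
theorem binomPMF_eq_zero_of_lt (N : ℕ) (q : ℝ) {ℓ : ℕ} (h : N < ℓ) : binomPMF N q ℓ = 0 := by
  simp [binomPMF, Nat.choose_eq_zero_of_lt h]

/-- Total mass `Σ_{ℓ ≤ N} B(ℓ) = (q + (1 − q))^N = 1` (any real `q`). [folklore] -/
theorem sum_binomPMF (N : ℕ) (q : ℝ) : ∑ ℓ ∈ range (N + 1), binomPMF N q ℓ = 1 := by
  have h := add_pow q (1 - q) N
  rw [add_sub_cancel, one_pow] at h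
  rw [h]
  refine Finset.sum_congr rfl fun ℓ _ => ?_
  unfold binomPMF
  ring

/-- A shifted window of masses is at most the total mass: `Σ_{t < M} B(m + t) ≤ 1` (`q ∈ [0,1]`; the levels
above `N` carry no mass). [folklore] -/
theorem sum_binomPMF_shift_le_one (N : ℕ) {q : ℝ} (hq0 : 0 ≤ q) (hq1 : q ≤ 1) (m M : ℕ) :
    ∑ t ∈ range M, binomPMF N q (m + t) ≤ 1 := by
  calc ∑ t ∈ range M, binomPMF N q (m + t) = ∑ ℓ ∈ Ico m (m + M), binomPMF N q ℓ := by
        rw [Finset.sum_Ico_eq_sum_range, Nat.add_sub_cancel_left]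
    _ ≤ ∑ ℓ ∈ Ico m (m + M) ∪ range (N + 1), binomPMF N q ℓ :=
        Finset.sum_le_sum_of_subset_of_nonneg subset_union_left fun ℓ _ _ => binomPMF_nonneg N hq0 hq1 ℓ
    _ = ∑ ℓ ∈ range (N + 1), binomPMF N q ℓ := by
        refine (Finset.sum_subset subset_union_right fun ℓ _ hℓ => ?_).symm
        rw [Finset.mem_range] at hℓ
        exact binomPMF_eq_zero_of_lt N q (by omega)
    _ = 1 := sum_binomPMF N q

/-! ### Log-concavity (decreasing ratios) and the two tail bounds -/

/-- Log-concavity of the binomial masses in product form: for `a ≤ b` and every shift `t`,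
`B(b+t)·B(a) ≤ B(a+t)·B(b)`, i.e. the ratios `B(ℓ+1)/B(ℓ) = (N−ℓ)q/((ℓ+1)(1−q))` decrease in `ℓ`
(induction on `t` through the ratio identity, no division). [folklore] -/
theorem binomPMF_mul_le (N : ℕ) {q : ℝ} (hq0 : 0 ≤ q) (hq1 : q < 1) {a b : ℕ} (hab : a ≤ b) (t : ℕ) :
    binomPMF N q (b + t) * binomPMF N q a ≤ binomPMF N q (a + t) * binomPMF N q b := by
  induction t with
  | zero => rw [add_zero, add_zero, mul_comm]
  | succ t ih =>
    rw [← add_assoc, ← add_assoc]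
    have h1 := binomPMF_succ_ratio N (b + t) q
    have h2 := binomPMF_succ_ratio N (a + t) q
    have hcoef : (((a + t : ℕ) : ℝ) + 1) * ((N - (b + t) : ℕ) : ℝ) ≤
        (((b + t : ℕ) : ℝ) + 1) * ((N - (a + t) : ℕ) : ℝ) := by
      exact_mod_cast (Nat.mul_le_mul (by omega) (by omega) :
        (a + t + 1) * (N - (b + t)) ≤ (b + t + 1) * (N - (a + t)))
    have hq1' : 0 < 1 - q := sub_pos.2 hq1
    have hBb := binomPMF_nonneg N hq0 hq1.le b
    have hBat := binomPMF_nonneg N hq0 hq1.le (a + t)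
    refine le_of_mul_le_mul_left ?_
      (show (0 : ℝ) < (((b + t : ℕ) : ℝ) + 1) * (((a + t : ℕ) : ℝ) + 1) * (1 - q) by positivity)
    calc (((b + t : ℕ) : ℝ) + 1) * (((a + t : ℕ) : ℝ) + 1) * (1 - q) *
          (binomPMF N q (b + t + 1) * binomPMF N q a)
        = (((a + t : ℕ) : ℝ) + 1) * ((N - (b + t) : ℕ) : ℝ) * q * (binomPMF N q (b + t) * binomPMF N q a) := by
          linear_combination ((((a + t : ℕ) : ℝ) + 1) * binomPMF N q a) * h1
      _ ≤ (((a + t : ℕ) : ℝ) + 1) * ((N - (b + t) : ℕ) : ℝ) * q * (binomPMF N q (a + t) * binomPMF N q b) :=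
          mul_le_mul_of_nonneg_left ih (mul_nonneg (mul_nonneg (by positivity) (Nat.cast_nonneg _)) hq0)
      _ ≤ (((b + t : ℕ) : ℝ) + 1) * ((N - (a + t) : ℕ) : ℝ) * q * (binomPMF N q (a + t) * binomPMF N q b) :=
          mul_le_mul_of_nonneg_right (mul_le_mul_of_nonneg_right hcoef hq0) (mul_nonneg hBat hBb)
      _ = _ := by linear_combination (-((((b + t : ℕ) : ℝ) + 1) * binomPMF N q b)) * h2

/-- Upper tail against the right neighbour of `j`: for `j ≤ i`, `P[X ≥ i+1]·B(j+1) ≤ B(i+1)`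
(termwise `B(i+1+t)·B(j+1) ≤ B(j+1+t)·B(i+1)`, and `Σ_t B(j+1+t) ≤ 1`). [folklore] -/
theorem upperTail_mul_le (N : ℕ) {q : ℝ} (hq0 : 0 ≤ q) (hq1 : q < 1) {j i : ℕ} (hji : j ≤ i) :
    (∑ ℓ ∈ Ioc i N, binomPMF N q ℓ) * binomPMF N q (j + 1) ≤ binomPMF N q (i + 1) := by
  rw [← Finset.Ico_add_one_add_one_eq_Ioc, Finset.sum_Ico_eq_sum_range, Finset.sum_mul]
  calc ∑ t ∈ range (N + 1 - (i + 1)), binomPMF N q (i + 1 + t) * binomPMF N q (j + 1)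
      ≤ ∑ t ∈ range (N + 1 - (i + 1)), binomPMF N q (j + 1 + t) * binomPMF N q (i + 1) :=
        Finset.sum_le_sum fun t _ => binomPMF_mul_le N hq0 hq1 (by omega) t
    _ ≤ 1 * binomPMF N q (i + 1) := by
        rw [← Finset.sum_mul]
        exact mul_le_mul_of_nonneg_right (sum_binomPMF_shift_le_one N hq0 hq1.le _ _)
          (binomPMF_nonneg N hq0 hq1.le _)
    _ = binomPMF N q (i + 1) := one_mul _

/-- Lower tail against the left neighbour of `j`: for `i < j`, `P[X ≤ i]·B(j−1) ≤ B(i)`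
(termwise `B(j−1)·B(ℓ) ≤ B(ℓ+(j−1−i))·B(i)` for `ℓ ≤ i`). [folklore] -/
theorem lowerTail_mul_le (N : ℕ) {q : ℝ} (hq0 : 0 ≤ q) (hq1 : q < 1) {j i : ℕ} (hij : i < j) :
    (∑ ℓ ∈ range (i + 1), binomPMF N q ℓ) * binomPMF N q (j - 1) ≤ binomPMF N q i := by
  rw [Finset.sum_mul, show j - 1 = i + (j - 1 - i) by omega]
  calc ∑ ℓ ∈ range (i + 1), binomPMF N q ℓ * binomPMF N q (i + (j - 1 - i))
      ≤ ∑ ℓ ∈ range (i + 1), binomPMF N q ((j - 1 - i) + ℓ) * binomPMF N q i :=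
        Finset.sum_le_sum fun ℓ hℓ => by
          rw [mul_comm, add_comm _ ℓ]
          exact binomPMF_mul_le N hq0 hq1 (Nat.lt_succ_iff.1 (mem_range.1 hℓ)) _
    _ ≤ 1 * binomPMF N q i := by
        rw [← Finset.sum_mul]
        exact mul_le_mul_of_nonneg_right (sum_binomPMF_shift_le_one N hq0 hq1.le _ _)
          (binomPMF_nonneg N hq0 hq1.le _)
    _ = binomPMF N q i := one_mul _

/-! ### The slice density `q = j/N`: `j` is a mode, and its neighbours carry at least half its mass -/

/-- `0 ≤ j/N`. [folklore] -/
theorem slice_q_nonneg (N j : ℕ) : (0 : ℝ) ≤ (j : ℝ) / N := by positivity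

/-- `j/N < 1` for `j < N`. [folklore] -/
theorem slice_q_lt_one {N j : ℕ} (hjN : j < N) : (j : ℝ) / N < 1 :=
  (div_lt_one (by exact_mod_cast (Nat.zero_le j).trans_lt hjN)).2 (by exact_mod_cast hjN)

/-- The ratio identity at `q = j/N`, cleared of denominators: `(ℓ+1)(N−j)·B(ℓ+1) = (N−ℓ)j·B(ℓ)`. [folklore] -/
theorem binomPMF_succ_ratio_slice {N j : ℕ} (hjN : j < N) (ℓ : ℕ) :
    ((ℓ : ℝ) + 1) * ((N : ℝ) - j) * binomPMF N (j / N) (ℓ + 1) =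
      ((N - ℓ : ℕ) : ℝ) * j * binomPMF N (j / N) ℓ := by
  have h := binomPMF_succ_ratio N ℓ ((j : ℝ) / N)
  have hq : (j : ℝ) / N * N = j := div_mul_cancel₀ _ (Nat.cast_ne_zero.2 (by omega))
  linear_combination (N : ℝ) * h +
    (((ℓ : ℝ) + 1) * binomPMF N (j / N) (ℓ + 1) + ((N - ℓ : ℕ) : ℝ) * binomPMF N (j / N) ℓ) * hq

/-- Below the mode the masses increase: `B(ℓ) ≤ B(ℓ+1)` for `ℓ + 1 ≤ j` (`q = j/N`). [folklore] -/
theorem binomPMF_step_up {N j ℓ : ℕ} (hjN : j < N) (hℓ : ℓ + 1 ≤ j) :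
    binomPMF N (j / N) ℓ ≤ binomPMF N (j / N) (ℓ + 1) := by
  have h := binomPMF_succ_ratio_slice hjN ℓ
  have hc : ((ℓ : ℝ) + 1) * ((N : ℝ) - j) ≤ (j : ℝ) * ((N - ℓ : ℕ) : ℝ) := by
    rw [← Nat.cast_sub hjN.le]
    exact_mod_cast (Nat.mul_le_mul hℓ (by omega) : (ℓ + 1) * (N - j) ≤ j * (N - ℓ))
  have hlt : (j : ℝ) < N := by exact_mod_cast hjN
  have hB := binomPMF_nonneg N (slice_q_nonneg N j) (slice_q_lt_one hjN).le ℓ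
  nlinarith [mul_le_mul_of_nonneg_right hc hB, mul_pos (by positivity : (0 : ℝ) < (ℓ : ℝ) + 1) (sub_pos.2 hlt)]

/-- Above the mode the masses decrease: `B(ℓ+1) ≤ B(ℓ)` for `j ≤ ℓ` (`q = j/N`, `0 < j`). [folklore] -/
theorem binomPMF_step_down {N j ℓ : ℕ} (hj : 0 < j) (hjN : j < N) (hℓ : j ≤ ℓ) :
    binomPMF N (j / N) (ℓ + 1) ≤ binomPMF N (j / N) ℓ := by
  rcases lt_or_ge ℓ N with hℓN | hℓN
  · have h := binomPMF_succ_ratio_slice hjN ℓ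
    have hc : (j : ℝ) * ((N - ℓ : ℕ) : ℝ) ≤ ((ℓ : ℝ) + 1) * ((N : ℝ) - j) := by
      rw [← Nat.cast_sub hjN.le]
      exact_mod_cast (Nat.mul_le_mul (by omega) (by omega) : j * (N - ℓ) ≤ (ℓ + 1) * (N - j))
    have h1 : (0 : ℝ) < ((N - ℓ : ℕ) : ℝ) := by exact_mod_cast Nat.sub_pos_of_lt hℓN
    have hB := binomPMF_nonneg N (slice_q_nonneg N j) (slice_q_lt_one hjN).le (ℓ + 1)
    nlinarith [mul_le_mul_of_nonneg_right hc hB, mul_pos (by exact_mod_cast hj : (0 : ℝ) < j) h1]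
  · rw [binomPMF_eq_zero_of_lt N _ (by omega : N < ℓ + 1)]
    exact binomPMF_nonneg N (slice_q_nonneg N j) (slice_q_lt_one hjN).le ℓ

/-- `j` is a mode of `Bin(N, j/N)`: `B(ℓ) ≤ B(j)` for every `ℓ`. [folklore] -/
theorem binomPMF_le_mode {N j : ℕ} (hj : 0 < j) (hjN : j < N) (ℓ : ℕ) :
    binomPMF N (j / N) ℓ ≤ binomPMF N (j / N) j := by
  rcases le_or_gt ℓ j with h | h
  · have key : ∀ d ℓ, ℓ + d = j → binomPMF N (j / N) ℓ ≤ binomPMF N (j / N) j := by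
      intro d
      induction d with
      | zero => intro ℓ h; rw [← h, add_zero]
      | succ d ih => exact fun ℓ h => (binomPMF_step_up hjN (by omega)).trans (ih (ℓ + 1) (by omega))
    exact key (j - ℓ) ℓ (by omega)
  · have key : ∀ d, binomPMF N (j / N) (j + d) ≤ binomPMF N (j / N) j := by
      intro d
      induction d with
      | zero => rw [add_zero]
      | succ d ih => exact (binomPMF_step_down hj hjN (Nat.le_add_right j d)).trans ih
    simpa [Nat.add_sub_cancel' h.le] using key (ℓ - j)

/-- Right neighbour of the mode: `B(j) ≤ 2·B(j+1)` (the ratio `B(j+1)/B(j)` is `j/(j+1) ≥ 1/2`). [folklore] -/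
theorem binomPMF_mode_le_two_mul_succ {N j : ℕ} (hj : 0 < j) (hjN : j < N) :
    binomPMF N (j / N) j ≤ 2 * binomPMF N (j / N) (j + 1) := by
  have h := binomPMF_succ_ratio_slice hjN j
  rw [Nat.cast_sub hjN.le] at h
  have hNj : (0 : ℝ) < (N : ℝ) - j := sub_pos.2 (by exact_mod_cast hjN)
  have hj' : (1 : ℝ) ≤ j := by exact_mod_cast hj
  have hB := binomPMF_nonneg N (slice_q_nonneg N j) (slice_q_lt_one hjN).le j
  have e : ((j : ℝ) + 1) * binomPMF N (j / N) (j + 1) = j * binomPMF N (j / N) j :=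
    mul_left_cancel₀ hNj.ne' (by linear_combination h)
  have hjp : (0 : ℝ) < (j : ℝ) + 1 := by positivity
  nlinarith [mul_le_mul_of_nonneg_right hj' hB]

/-- Left neighbour of the mode: `B(j) ≤ 2·B(j−1)` (the ratio `B(j−1)/B(j)` is `(N−j)/(N−j+1) ≥ 1/2`).
[folklore] -/
theorem binomPMF_mode_le_two_mul_pred {N j : ℕ} (hj : 0 < j) (hjN : j < N) :
    binomPMF N (j / N) j ≤ 2 * binomPMF N (j / N) (j - 1) := by
  have h := binomPMF_succ_ratio_slice hjN (j - 1)
  have e2 : ((j - 1 : ℕ) : ℝ) + 1 = j := by rw [Nat.cast_sub hj, Nat.cast_one]; ring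
  have e3 : ((N - (j - 1) : ℕ) : ℝ) = (N : ℝ) - j + 1 := by
    rw [Nat.cast_sub (by omega), Nat.cast_sub hj, Nat.cast_one]; ring
  rw [Nat.sub_add_cancel hj, e2, e3] at h
  have hB := binomPMF_nonneg N (slice_q_nonneg N j) (slice_q_lt_one hjN).le j
  have e : ((N : ℝ) - j) * binomPMF N (j / N) j = ((N : ℝ) - j + 1) * binomPMF N (j / N) (j - 1) :=
    mul_left_cancel₀ (by exact_mod_cast hj.ne' : (j : ℝ) ≠ 0) (by linear_combination h)
  have hNj : (j : ℝ) + 1 ≤ N := by exact_mod_cast hjN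
  have hNj' : (0 : ℝ) < (N : ℝ) - j + 1 := by linarith
  nlinarith [mul_le_mul_of_nonneg_right hNj hB]

/-! ### The modal mass: variance, Chebyshev, counting -/

/-- The variance of `Bin(N, j/N)` as a finite sum, `Σ_ℓ (ℓ − j)²·B(ℓ) = j(1 − j/N) ≤ j`
(`bernsteinPolynomial.variance` evaluated at `j/N`). [folklore] -/
theorem sum_sq_mul_binomPMF_le {N j : ℕ} (hjN : j < N) :
    ∑ ℓ ∈ range (N + 1), ((ℓ : ℝ) - j) ^ 2 * binomPMF N (j / N) ℓ ≤ j := by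
  have h := congrArg (Polynomial.eval ((j : ℝ) / N)) (bernsteinPolynomial.variance ℝ N)
  simp only [Polynomial.eval_finsetSum, Polynomial.eval_mul, Polynomial.eval_pow, Polynomial.eval_sub,
    Polynomial.eval_X, Polynomial.eval_natCast, Polynomial.eval_one, nsmul_eq_mul, bernsteinPolynomial] at h
  rw [mul_div_cancel₀ _ (Nat.cast_ne_zero.2 (by omega) : (N : ℝ) ≠ 0)] at h
  calc ∑ ℓ ∈ range (N + 1), ((ℓ : ℝ) - j) ^ 2 * binomPMF N (j / N) ℓ
      = ∑ ℓ ∈ range (N + 1), ((j : ℝ) - ℓ) ^ 2 *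
          ((N.choose ℓ : ℝ) * ((j : ℝ) / N) ^ ℓ * (1 - (j : ℝ) / N) ^ (N - ℓ)) :=
        Finset.sum_congr rfl fun ℓ _ => by unfold binomPMF; ring
    _ = j * (1 - (j : ℝ) / N) := h
    _ ≤ j := by nlinarith [mul_nonneg (Nat.cast_nonneg j) (slice_q_nonneg N j)]

/-- Modal lower bound `3 ≤ 20·√j·B(j)`: by Chebyshev at least `3/4` of the mass sits on the levels `ℓ` with
`(ℓ − j)² < 4j`; these lie in the window `|ℓ − j| ≤ ⌊√(4j)⌋`, at most `4√j + 1 ≤ 5√j` levels, each of mass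
`≤ B(j)`. [folklore] -/
theorem sqrt_mul_binomPMF_mode_ge {N j : ℕ} (hj : 0 < j) (hjN : j < N) :
    3 ≤ 20 * Real.sqrt j * binomPMF N (j / N) j := by
  have hBn := binomPMF_nonneg N (slice_q_nonneg N j) (slice_q_lt_one hjN).le
  have hjpos : (0 : ℝ) < j := by exact_mod_cast hj
  set w := Nat.sqrt (4 * j) with hw
  set S := (range (N + 1)).filter (fun ℓ : ℕ => ((ℓ : ℝ) - j) ^ 2 < 4 * j) with hS
  set T := (range (N + 1)).filter (fun ℓ : ℕ => ¬ ((ℓ : ℝ) - j) ^ 2 < 4 * j) with hT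
  -- Chebyshev: the far levels `T` carry mass `≤ 1/4`, so the near levels `S` carry mass `≥ 3/4`
  have hfar : 4 * j * ∑ ℓ ∈ T, binomPMF N (j / N) ℓ ≤ j := by
    rw [Finset.mul_sum]
    calc ∑ ℓ ∈ T, 4 * j * binomPMF N (j / N) ℓ ≤ ∑ ℓ ∈ T, ((ℓ : ℝ) - j) ^ 2 * binomPMF N (j / N) ℓ :=
          Finset.sum_le_sum fun ℓ hℓ => mul_le_mul_of_nonneg_right (not_lt.1 (mem_filter.1 hℓ).2) (hBn ℓ)
      _ ≤ ∑ ℓ ∈ range (N + 1), ((ℓ : ℝ) - j) ^ 2 * binomPMF N (j / N) ℓ :=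
          Finset.sum_le_sum_of_subset_of_nonneg (filter_subset _ _) fun ℓ _ _ =>
            mul_nonneg (sq_nonneg _) (hBn ℓ)
      _ ≤ j := sum_sq_mul_binomPMF_le hjN
  have hfar' : 4 * ∑ ℓ ∈ T, binomPMF N (j / N) ℓ ≤ 1 :=
    le_of_mul_le_mul_left (by linarith) hjpos
  have hsplit : ∑ ℓ ∈ S, binomPMF N (j / N) ℓ + ∑ ℓ ∈ T, binomPMF N (j / N) ℓ = 1 := by
    rw [← sum_binomPMF N ((j : ℝ) / N)]
    exact Finset.sum_filter_add_sum_filter_not _ _ _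
  -- the near levels lie in a window of `2w + 1` integers, `w = ⌊√(4j)⌋ ≤ 2√j`
  have hsub : S ⊆ Icc (j - w) (j + w) := by
    intro ℓ hℓ
    have hlt : ((ℓ : ℝ) - j) ^ 2 < 4 * j := (mem_filter.1 hℓ).2
    have hw1 : (4 * j : ℝ) < ((w : ℝ) + 1) ^ 2 := by exact_mod_cast Nat.lt_succ_sqrt' (4 * j)
    rw [mem_Icc]
    constructor <;> by_contra hcon
    · have h1 : ((ℓ + w + 1 : ℕ) : ℝ) ≤ j := by exact_mod_cast (by omega)
      push_cast at h1
      linarith [pow_le_pow_left₀ (by positivity) (by linarith : (w : ℝ) + 1 ≤ (j : ℝ) - ℓ) 2]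
    · have h1 : ((j + w + 1 : ℕ) : ℝ) ≤ ℓ := by exact_mod_cast (by omega)
      push_cast at h1
      linarith [pow_le_pow_left₀ (by positivity) (by linarith : (w : ℝ) + 1 ≤ (ℓ : ℝ) - j) 2]
  have hcard : (S.card : ℝ) ≤ 2 * w + 1 := by
    have h1 := Finset.card_le_card hsub
    rw [Nat.card_Icc] at h1
    exact_mod_cast h1.trans (by omega)
  have hw2 : (w : ℝ) ≤ 2 * Real.sqrt j := by
    have h1 : ((w : ℕ) : ℝ) ^ 2 ≤ ((4 * j : ℕ) : ℝ) := by exact_mod_cast Nat.sqrt_le' (4 * j)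
    refine (sq_le_sq₀ (Nat.cast_nonneg _) (by positivity)).1 ?_
    rw [mul_pow, Real.sq_sqrt (Nat.cast_nonneg _)]
    push_cast at h1
    linarith
  have hsj : (1 : ℝ) ≤ Real.sqrt j := Real.one_le_sqrt.2 (by exact_mod_cast hj)
  -- near mass `≤ (#S)·B(j) ≤ (2w+1)·B(j) ≤ 5√j·B(j)`
  have hle : ∑ ℓ ∈ S, binomPMF N (j / N) ℓ ≤ S.card * binomPMF N (j / N) j := by
    rw [← nsmul_eq_mul, ← Finset.sum_const]
    exact Finset.sum_le_sum fun ℓ _ => binomPMF_le_mode hj hjN ℓ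
  have hBj := hBn j
  linarith [mul_le_mul_of_nonneg_right hcard hBj, mul_le_mul_of_nonneg_right hw2 hBj,
    mul_le_mul_of_nonneg_right hsj hBj]

/-! ### The stub -/

/-- Arithmetic core of the hazard estimate: a tail bound `W·P ≤ X`, a neighbour bound `M ≤ 2P` and the modal
bound `3 ≤ 20·s·M` (`s = √j`, `s·s = j`) give `3·s·W ≤ 40·j·X`. [folklore] -/
theorem hazard_core {s W M P X c : ℝ} (hs : 0 ≤ s) (hW : 0 ≤ W) (hc : 0 ≤ c)
    (hmode : 3 ≤ 20 * s * M) (hn : M ≤ 2 * P) (hT : W * P ≤ X) (hsq : s * s = c) :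
    3 * s * W ≤ 40 * c * X := by
  calc 3 * s * W ≤ 20 * s * M * s * W := by nlinarith [mul_le_mul_of_nonneg_right hmode (mul_nonneg hs hW)]
    _ = 20 * c * M * W := by rw [← hsq]; ring
    _ ≤ 20 * c * (2 * P) * W := mul_le_mul_of_nonneg_right (mul_le_mul_of_nonneg_left hn (by positivity)) hW
    _ = 40 * c * (W * P) := by ring
    _ ≤ 40 * c * X := mul_le_mul_of_nonneg_left hT (by positivity)

end BinomialHazard

open BinomialHazard in
/-- **Binomial hazard estimate** (stub `stub_binomialHazard` of the line `russo-window-ladder`). With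
`K₀ = 40/3`: for `0 < j < N`, `q = j/N` and every level `i < N`,
`w_{q,j}(i)/((N−i)C(N,i)) ≤ (K₀/√j)·q^{i+1}(1−q)^{N−1−i}`, i.e. `w_{q,j}(i) ≤ K₀(i+1)B(i+1)/√j`, where
`w_{q,j}(i) = hybridWeight N q j i` is `P[Bin(N,q) ≥ i+1]` for `j ≤ i` and `P[Bin(N,q) ≤ i]` for `i < j`.
Proof: the tail bounds `upperTail_mul_le` / `lowerTail_mul_le` (log-concavity), the neighbour bounds
`B(j±1) ≥ B(j)/2`, the modal bound `B(j) ≥ 3/(20√j)`, and `√j·√j = j ≤ i+1`, resp. `j·B(i) ≤ (i+1)·B(i+1)`;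
finally `(i+1)C(N,i+1) = (N−i)C(N,i)`. [folklore] -/
theorem stub_binomialHazard :
    ∃ K₀ : ℝ, 0 < K₀ ∧ ∀ (N j i : ℕ), 0 < j → j < N → i < N →
      hybridWeight N ((j : ℝ) / N) j i / (((N - i : ℕ) : ℝ) * (N.choose i : ℝ)) ≤
        K₀ / Real.sqrt j * (((j : ℝ) / N) ^ (i + 1) * (1 - (j : ℝ) / N) ^ (N - 1 - i)) := by
  refine ⟨40 / 3, by norm_num, ?_⟩
  intro N j i hj hjN hiN
  have hq0 : (0 : ℝ) ≤ (j : ℝ) / N := slice_q_nonneg N j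
  have hq1 : (j : ℝ) / N < 1 := slice_q_lt_one hjN
  have hBn := binomPMF_nonneg N hq0 hq1.le
  have hs : (0 : ℝ) < Real.sqrt j := Real.sqrt_pos.2 (by exact_mod_cast hj)
  have hsq : Real.sqrt j * Real.sqrt j = j := Real.mul_self_sqrt (Nat.cast_nonneg _)
  have hmode := sqrt_mul_binomPMF_mode_ge hj hjN
  -- the hazard bound `3√j·w(i) ≤ 40(i+1)B(i+1)`
  have hmain : 3 * Real.sqrt j * hybridWeight N ((j : ℝ) / N) j i ≤
      40 * ((i : ℝ) + 1) * binomPMF N (j / N) (i + 1) := by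
    unfold hybridWeight
    split_ifs with hji
    · have hji' : (j : ℝ) ≤ (i : ℝ) + 1 := by exact_mod_cast Nat.le_succ_of_le hji
      calc 3 * Real.sqrt j * ∑ ℓ ∈ Ioc i N, binomPMF N ((j : ℝ) / N) ℓ ≤ 40 * j * binomPMF N (j / N) (i + 1) :=
            hazard_core hs.le (Finset.sum_nonneg fun ℓ _ => hBn ℓ) (Nat.cast_nonneg _) hmode
              (binomPMF_mode_le_two_mul_succ hj hjN) (upperTail_mul_le N hq0 hq1 hji) hsq
        _ ≤ 40 * ((i : ℝ) + 1) * binomPMF N (j / N) (i + 1) :=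
            mul_le_mul_of_nonneg_right (by linarith) (hBn _)
    · have hij : i < j := not_le.1 hji
      -- `j·B(i) ≤ (i+1)·B(i+1)` from the ratio identity, as `(N−i)j/(N−j) ≥ j`
      have hR : (j : ℝ) * binomPMF N (j / N) i ≤ ((i : ℝ) + 1) * binomPMF N (j / N) (i + 1) := by
        have h := binomPMF_succ_ratio_slice hjN i
        have hNj : (0 : ℝ) < (N : ℝ) - j := sub_pos.2 (by exact_mod_cast hjN)
        have hc : (N : ℝ) - j ≤ ((N - i : ℕ) : ℝ) := by
          rw [Nat.cast_sub hiN.le]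
          linarith [(by exact_mod_cast hij.le : (i : ℝ) ≤ j)]
        have hjB : (0 : ℝ) ≤ (j : ℝ) * binomPMF N (j / N) i := mul_nonneg (Nat.cast_nonneg _) (hBn i)
        nlinarith [mul_le_mul_of_nonneg_right hc hjB]
      calc 3 * Real.sqrt j * ∑ ℓ ∈ range (i + 1), binomPMF N ((j : ℝ) / N) ℓ ≤ 40 * j * binomPMF N (j / N) i :=
            hazard_core hs.le (Finset.sum_nonneg fun ℓ _ => hBn ℓ) (Nat.cast_nonneg _) hmode
              (binomPMF_mode_le_two_mul_pred hj hjN) (lowerTail_mul_le N hq0 hq1 hij) hsq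
        _ ≤ 40 * ((i : ℝ) + 1) * binomPMF N (j / N) (i + 1) := by linarith
  -- `(i+1)·B(i+1) = (N−i)·C(N,i)·q^{i+1}(1−q)^{N−1−i}`
  have hE : ((i : ℝ) + 1) * binomPMF N ((j : ℝ) / N) (i + 1) =
      ((N - i : ℕ) : ℝ) * (N.choose i : ℝ) * (((j : ℝ) / N) ^ (i + 1) * (1 - (j : ℝ) / N) ^ (N - 1 - i)) := by
    have hc : ((N.choose (i + 1) : ℕ) : ℝ) * ((i : ℝ) + 1) = (N.choose i : ℝ) * ((N - i : ℕ) : ℝ) := by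
      exact_mod_cast Nat.choose_succ_right_eq N i
    unfold binomPMF
    rw [show N - (i + 1) = N - 1 - i by omega]
    linear_combination (((j : ℝ) / N) ^ (i + 1) * (1 - (j : ℝ) / N) ^ (N - 1 - i)) * hc
  have hpos : (0 : ℝ) < ((N - i : ℕ) : ℝ) * (N.choose i : ℝ) :=
    mul_pos (by exact_mod_cast Nat.sub_pos_of_lt hiN) (by exact_mod_cast Nat.choose_pos hiN.le)
  rw [div_le_iff₀ hpos]
  calc hybridWeight N ((j : ℝ) / N) j i
      ≤ 40 * ((i : ℝ) + 1) * binomPMF N ((j : ℝ) / N) (i + 1) / (3 * Real.sqrt j) := by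
        rw [le_div_iff₀ (by positivity)]
        linarith [hmain]
    _ = 40 / 3 / Real.sqrt j * (((j : ℝ) / N) ^ (i + 1) * (1 - (j : ℝ) / N) ^ (N - 1 - i)) *
          (((N - i : ℕ) : ℝ) * (N.choose i : ℝ)) := by
        rw [mul_assoc (40 : ℝ), hE]
        field_simp

end Summit.PneNP.PneNP.Cruxes.SliceACZero.RussoWindowLadder
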